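import Summits.KontsevichZagierPeriods.KontsevichZagierPeriods.Theorems.LinRedNormalFormArrangementNormalFormStubRebaseSimplePosOnePosHUDirs

/-!
# Stub `stub_rebaseSimplePosOnePos` (crux `ArrangementNormalForm`, line `janus-bands`) —
part `HUChoice`: the generic re-selection directions at a triple point (`B = 2`)

Towards the residue `HU` of the one-fibre rebase over the base `(x₁, x₂, y)`. For a thin
parallel cell (bounds `u`, `v = u + w(x')`, slope `s = u_y ≠ 0`, width gradient `∇w ≠ 0`) with
triple point `X` of the silent plane, `y`-value `Y` there and base pole `ℓ₂` with
`Y ≠ ℓ₂(X)`, this file CHOOSES the data of the re-selection (parts `HUSplit`, `HURatio`):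
a slope `q > 0` and a level parameter `θ ∈ (0, 1)`, both rational, such that for EACH of the four
quadrants `(σ₀, σ₁)` at `X` the direction `d = (σ₀, −σ₁ q, ν)` (`RebasePos.dirQ`) with the
`y`-component `ν = −(∂u + θ ∂w)/s` making the level `u + θ w` invariant (`RebasePos.nuQ`)
satisfies the algebraic hypotheses of `RebasePos.good_chamber`: `ν ≠ 0`, `∂_d u ≠ 0`,
`∂_d (u + θ (v − u)) = 0`, every active non-constant letter of `jjL L ℓ₂` is moved by `d`, the
resultant of every relevant ordered pair other than a pair of near silent factors does not
vanish at `P₀ = (X, Y)`, and the far letters do not vanish at `P₀`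
(`RebasePos.exists_goodDirs`, registered as `rebaseSimplePos_goodDirs`). Finitely many values
of `q` and then of `θ` are excluded (`RebasePos.exists_large_avoid`, `exists_small_avoid`, part
`HUDirs`): `q`
must move `w` and every active non-constant silent factor and separate the far–far resultants,
`θ` must keep `ν` away from `0`, from the value fixing the pole form, and from the values
annihilating the pole–far resultants. A far–far pair whose resultant vanishes for every `q` is a
pair of proportional letters (`RebasePos.smul_eq_of_brackets`), which the engine never splits.

References: M. Kontsevich, D. Zagier, *Periods* (2001), §1.2.
-/

noncomputable section

open Set MeasureTheory MvPolynomial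
open Literature.NumberTheory.Transcendental Literature.ModelTheory.ExponentialFields

namespace Summit.KontsevichZagierPeriods.ArrangementNormalForm.JanusBands

namespace RebasePos

open SeparatePos

section Choice

variable {m : ℕ}

variable (L : Fin m → (Fin 2 → ℚ) × ℚ) (e : Fin m → ℕ) (ℓ₂ : (Fin 2 → ℚ) × ℚ)

/-- **The generic re-selection directions at a triple point.** See the module docstring. -/
theorem exists_goodDirs (u v : (Fin (2 + 1) → ℚ) × ℚ) (X : Fin 2 → ℚ) (Y : ℚ)
    (hu : u.1 2 ≠ 0) (hpar : u.1 2 = v.1 2) (hw : (v - u).1 0 ≠ 0 ∨ (v - u).1 1 ≠ 0)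
    (hY : Y - valX ℓ₂ X ≠ 0) :
    ∃ q : ℚ, 0 < q ∧ ∃ θ : ℚ, 0 < θ ∧ θ < 1 ∧ ∀ σ₀ σ₁ : ℚ, σ₀ * σ₀ = 1 → σ₁ * σ₁ = 1 →
      dirQ σ₀ σ₁ q (nuQ u v σ₀ σ₁ q θ) (Fin.last 2) ≠ 0 ∧
      dd u (dirQ σ₀ σ₁ q (nuQ u v σ₀ σ₁ q θ)) ≠ 0 ∧
      dd u (dirQ σ₀ σ₁ q (nuQ u v σ₀ σ₁ q θ)) + θ * dd (v - u) (dirQ σ₀ σ₁ q (nuQ u v σ₀ σ₁ q θ)) = 0 ∧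
      (∀ j, jjE e j ≠ 0 → (jjL L ℓ₂ j).1 ≠ 0 → dd (jjL L ℓ₂ j) (dirQ σ₀ σ₁ q (nuQ u v σ₀ σ₁ q θ)) ≠ 0) ∧
      (∀ j j', jjE e j ≠ 0 → jjE e j' ≠ 0 → dd (jjL L ℓ₂ j) (dirQ σ₀ σ₁ q (nuQ u v σ₀ σ₁ q θ)) ≠ 0 →
        dd (jjL L ℓ₂ j') (dirQ σ₀ σ₁ q (nuQ u v σ₀ σ₁ q θ)) ≠ 0 →
        dd (jjL L ℓ₂ j') (dirQ σ₀ σ₁ q (nuQ u v σ₀ σ₁ q θ)) • jjL L ℓ₂ j ≠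
          dd (jjL L ℓ₂ j) (dirQ σ₀ σ₁ q (nuQ u v σ₀ σ₁ q θ)) • jjL L ℓ₂ j' →
        ¬ (∃ i i' : Fin m, j = Fin.castSucc i ∧ j' = Fin.castSucc i' ∧ valX (L i) X = 0 ∧ valX (L i') X = 0) →
        evQ (resF (jjL L ℓ₂ j) (jjL L ℓ₂ j') (dirQ σ₀ σ₁ q (nuQ u v σ₀ σ₁ q θ))) ![X 0, X 1, Y] ≠ 0) ∧
      (∀ j, jjE e j ≠ 0 → dd (jjL L ℓ₂ j) (dirQ σ₀ σ₁ q (nuQ u v σ₀ σ₁ q θ)) ≠ 0 →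
        ¬ (∃ i : Fin m, j = Fin.castSucc i ∧ valX (L i) X = 0) → evQ (jjL L ℓ₂ j) ![X 0, X 1, Y] ≠ 0) := by
  classical
  -- the two signs from a bit
  set sg : Fin 2 → ℚ := ![1, -1] with hsg
  have hsg0 : ∀ b, sg b ≠ 0 := fun b => by fin_cases b <;> simp [hsg]
  have hsg_of : ∀ σ : ℚ, σ * σ = 1 → ∃ b, σ = sg b := fun σ hσ => by
    rcases mul_self_eq_one_iff.1 hσ with h | h
    · exact ⟨0, by simp [hsg, h]⟩
    · exact ⟨1, by simp [hsg, h]⟩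
  -- abbreviations
  set w : (Fin (2 + 1) → ℚ) × ℚ := v - u with hwdef
  set vL : Fin m → ℚ := fun i => valX (L i) X with hvL
  set br0 : Fin m → Fin m → ℚ := fun i i' => (L i).1 0 * vL i' - (L i').1 0 * vL i with hbr0
  set br1 : Fin m → Fin m → ℚ := fun i i' => (L i).1 1 * vL i' - (L i').1 1 * vL i with hbr1
  -- STEP 1: the slope `q`
  obtain ⟨q, hq1, hq⟩ := exists_large_avoid (ι := (Fin 2 × Fin 2) × (Unit ⊕ (Fin m ⊕ (Fin m × Fin m))))
    (fun k => match k.2 with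
      | Sum.inl _ => w.1 0 * sg k.1.1
      | Sum.inr (Sum.inl i) => if (L i).1 0 ≠ 0 ∨ (L i).1 1 ≠ 0 then (L i).1 0 * sg k.1.1 else 1
      | Sum.inr (Sum.inr (i, i')) => if br0 i i' ≠ 0 ∨ br1 i i' ≠ 0 then br0 i i' * sg k.1.1 else 1)
    (fun k => match k.2 with
      | Sum.inl _ => -(w.1 1 * sg k.1.2)
      | Sum.inr (Sum.inl i) => if (L i).1 0 ≠ 0 ∨ (L i).1 1 ≠ 0 then -((L i).1 1 * sg k.1.2) else 0
      | Sum.inr (Sum.inr (i, i')) => if br0 i i' ≠ 0 ∨ br1 i i' ≠ 0 then -(br1 i i' * sg k.1.2) else 0)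
    (by
      rintro ⟨⟨b₀, b₁⟩, k⟩
      rcases k with _ | i | ⟨i, i'⟩
      · rcases hw with h | h
        · exact Or.inl (mul_ne_zero h (hsg0 b₀))
        · exact Or.inr (neg_ne_zero.2 (mul_ne_zero h (hsg0 b₁)))
      · by_cases hL : (L i).1 0 ≠ 0 ∨ (L i).1 1 ≠ 0
        · simp only [hL, if_true]
          rcases hL with h | h
          · exact Or.inl (mul_ne_zero h (hsg0 b₀))
          · exact Or.inr (neg_ne_zero.2 (mul_ne_zero h (hsg0 b₁)))
        · simp only [hL, if_false]
          exact Or.inl one_ne_zero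
      · by_cases hb : br0 i i' ≠ 0 ∨ br1 i i' ≠ 0
        · simp only [hb, if_true]
          rcases hb with h | h
          · exact Or.inl (mul_ne_zero h (hsg0 b₀))
          · exact Or.inr (neg_ne_zero.2 (mul_ne_zero h (hsg0 b₁)))
        · simp only [hb, if_false]
          exact Or.inl one_ne_zero)
  have hq0 : 0 < q := by linarith
  -- the three families of `q`-facts
  have hW : ∀ b₀ b₁ : Fin 2, w.1 0 * sg b₀ - w.1 1 * (sg b₁ * q) ≠ 0 := fun b₀ b₁ => by
    have h := hq ((b₀, b₁), Sum.inl ())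
    simp only at h
    intro h'; exact h (by linear_combination h')
  have hD : ∀ b₀ b₁ : Fin 2, ∀ i, ((L i).1 0 ≠ 0 ∨ (L i).1 1 ≠ 0) →
      (L i).1 0 * sg b₀ - (L i).1 1 * (sg b₁ * q) ≠ 0 := fun b₀ b₁ i hL => by
    have h := hq ((b₀, b₁), Sum.inr (Sum.inl i))
    simp only [hL, if_true] at h
    intro h'; exact h (by linear_combination h')
  have hFF : ∀ b₀ b₁ : Fin 2, ∀ i i', (br0 i i' ≠ 0 ∨ br1 i i' ≠ 0) →
      br0 i i' * sg b₀ - br1 i i' * (sg b₁ * q) ≠ 0 := fun b₀ b₁ i i' hb => by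
    have h := hq ((b₀, b₁), Sum.inr (Sum.inr (i, i')))
    simp only [hb, if_true] at h
    intro h'; exact h (by linear_combination h')
  -- STEP 2: the level parameter `θ`
  set U : Fin 2 → Fin 2 → ℚ := fun b₀ b₁ => u.1 0 * sg b₀ - u.1 1 * (sg b₁ * q) with hU
  set W : Fin 2 → Fin 2 → ℚ := fun b₀ b₁ => w.1 0 * sg b₀ - w.1 1 * (sg b₁ * q) with hWdef
  set κ₂ : Fin 2 → Fin 2 → ℚ := fun b₀ b₁ => ℓ₂.1 0 * sg b₀ - ℓ₂.1 1 * (sg b₁ * q) with hκ₂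
  set DL : Fin 2 → Fin 2 → Fin m → ℚ := fun b₀ b₁ i => (L i).1 0 * sg b₀ - (L i).1 1 * (sg b₁ * q) with hDL
  set κ₃ : Fin 2 → Fin 2 → Fin m → ℚ := fun b₀ b₁ i =>
    if vL i ≠ 0 then κ₂ b₀ b₁ + DL b₀ b₁ i * (Y - valX ℓ₂ X) / vL i else 0 with hκ₃
  obtain ⟨θ, hθ0, hθ1, hθ⟩ := exists_small_avoid (ι := (Fin 2 × Fin 2) × (Unit ⊕ (Unit ⊕ Fin m)))
    (fun k => match k.2 with
      | Sum.inl _ => U k.1.1 k.1.2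
      | Sum.inr (Sum.inl _) => U k.1.1 k.1.2 + u.1 2 * κ₂ k.1.1 k.1.2
      | Sum.inr (Sum.inr i) => U k.1.1 k.1.2 + u.1 2 * κ₃ k.1.1 k.1.2 i)
    (fun k => W k.1.1 k.1.2)
    (fun k => Or.inr (hW k.1.1 k.1.2))
  refine ⟨q, hq0, θ, hθ0, hθ1, fun σ₀ σ₁ hσ₀ hσ₁ => ?_⟩
  obtain ⟨b₀, rfl⟩ := hsg_of σ₀ hσ₀
  obtain ⟨b₁, rfl⟩ := hsg_of σ₁ hσ₁
  set ν : ℚ := nuQ u v (sg b₀) (sg b₁) q θ with hνdef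
  set d : Fin (2 + 1) → ℚ := dirQ (sg b₀) (sg b₁) q ν with hddef
  have hνval : ν = -(U b₀ b₁ + θ * W b₀ b₁) / u.1 2 := by rw [hνdef, nuQ]
  -- `ν` avoids the excluded values
  have hνne : ∀ c : ℚ, U b₀ b₁ + u.1 2 * c + W b₀ b₁ * θ ≠ 0 → ν ≠ c := fun c hc hνc => by
    refine hc ?_
    rw [hνval, div_eq_iff hu] at hνc
    linear_combination -hνc
  have hν0 : ν ≠ 0 := hνne 0 (by
    have h := hθ ((b₀, b₁), Sum.inl ())
    simpa using h)
  have hνκ₂ : ν ≠ κ₂ b₀ b₁ := hνne _ (hθ ((b₀, b₁), Sum.inr (Sum.inl ())))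
  have hνκ₃ : ∀ i, vL i ≠ 0 → ν ≠ κ₂ b₀ b₁ + DL b₀ b₁ i * (Y - valX ℓ₂ X) / vL i := fun i hi => by
    have h := hνne _ (hθ ((b₀, b₁), Sum.inr (Sum.inr i)))
    simp only [hκ₃, hi, ne_eq, not_false_eq_true, if_true] at h
    exact h
  -- the derivatives along `d`
  have hdu' : dd u d = U b₀ b₁ + u.1 2 * ν := by rw [hddef, dd_dirQ]
  have hdw : dd (v - u) d = W b₀ b₁ := by
    rw [hddef, dd_dirQ, show (v - u).1 2 = 0 by simp [hpar]]
    ring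
  have hlev : dd u d + θ * dd (v - u) d = 0 := by
    rw [hdu', hdw, hνval]
    field_simp
    ring
  have hdL : ∀ i, dd (jjL L ℓ₂ (Fin.castSucc i)) d = DL b₀ b₁ i := fun i => by
    rw [jjL_castSucc, hddef, dd_liftX_dirQ]
  have hdP : dd (jjL L ℓ₂ (Fin.last m)) d = ν - κ₂ b₀ b₁ := by
    rw [jjL_last, hddef, dd_poleX_dirQ]
    ring
  have hvP : evQ (jjL L ℓ₂ (Fin.last m)) ![X 0, X 1, Y] = Y - valX ℓ₂ X := by rw [jjL_last, evQ_poleX]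
  have hvL' : ∀ i, evQ (jjL L ℓ₂ (Fin.castSucc i)) ![X 0, X 1, Y] = vL i := fun i => by
    rw [jjL_castSucc, evQ_liftX]
  refine ⟨hν0, ?_, hlev, ?_, ?_, ?_⟩
  · -- `∂_d u ≠ 0`
    intro h0
    rw [h0, zero_add, mul_eq_zero] at hlev
    rcases hlev with h | h
    · exact (ne_of_gt hθ0) h
    · exact hW b₀ b₁ (hdw.symm.trans h)
  · -- every active non-constant letter is moved
    intro j he hne
    refine Fin.lastCases ?_ (fun i => ?_) j he hne
    · intro _ _
      rw [hdP]
      exact sub_ne_zero.2 hνκ₂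
    · intro _ hne'
      rw [hdL]
      rw [jjL_castSucc] at hne'
      exact hD b₀ b₁ i (grad_ne_of_liftX (L i) hne')
  · -- the resultants at `P₀`
    intro j j' he he' hα hα' hne hnn
    rw [evQ_resF]
    refine Fin.lastCases ?_ (fun i => ?_) j he hα hne hnn
    · -- `j` is the pole
      intro _ hαP hneP hnnP
      refine Fin.lastCases ?_ (fun i' => ?_) j' he' hα' hneP hnnP
      · intro _ _ hne'' _
        exact absurd rfl hne''
      · intro _ hα'' _ _
        rw [hdP, hdL, hvP, hvL']
        by_cases hi' : vL i' = 0
        · rw [hi', mul_zero, zero_sub, neg_ne_zero]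
          exact mul_ne_zero (by rwa [hdL] at hα'') hY
        · intro h0
          refine hνκ₃ i' hi' ?_
          have hi'' : vL i' ≠ 0 := hi'
          field_simp
          linear_combination h0
    · -- `j` is a silent factor
      intro _ hαi hnei hnni
      refine Fin.lastCases ?_ (fun i' => ?_) j' he' hα' hnei hnni
      · intro _ _ _ _
        rw [hdP, hdL, hvP, hvL']
        by_cases hi : vL i = 0
        · rw [hi, mul_zero, sub_zero]
          exact mul_ne_zero (by rwa [hdL] at hαi) hY
        · intro h0
          refine hνκ₃ i hi ?_
          have hi'' : vL i ≠ 0 := hi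
          field_simp
          linear_combination -h0
      · intro _ hα'' hne'' hnn''
        rw [hdL, hdL, hvL', hvL']
        rw [hdL] at hαi hα''
        by_cases hi : vL i = 0
        · by_cases hi' : vL i' = 0
          · exact absurd ⟨i, i', rfl, rfl, hi, hi'⟩ hnn''
          · rw [hi, mul_zero, sub_zero]
            exact mul_ne_zero hαi hi'
        · by_cases hi' : vL i' = 0
          · rw [hi', mul_zero, zero_sub, neg_ne_zero]
            exact mul_ne_zero hα'' hi
          · -- far–far
            by_cases hb : br0 i i' ≠ 0 ∨ br1 i i' ≠ 0
            · have h := hFF b₀ b₁ i i' hb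
              intro h0
              refine h ?_
              simp only [hbr0, hbr1, hDL] at h0 ⊢
              linear_combination h0
            · push Not at hb
              exfalso
              refine hne'' ?_
              rw [jjL_castSucc, jjL_castSucc]
              refine smul_eq_of_brackets (L i) (L i') X hi' ?_ ?_ d
              · linear_combination hb.1
              · linear_combination hb.2
  · -- the far letters at `P₀`
    intro j he hα hfar
    refine Fin.lastCases ?_ (fun i => ?_) j he hα hfar
    · intro _ _ _
      rw [hvP]
      exact hY
    · intro _ _ hfar'
      rw [hvL']
      exact fun h0 => hfar' ⟨i, rfl, h0⟩

end Choice

end RebasePos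

/-- **Registered part of `stub_rebaseSimplePosOnePos` (line `janus-bands`): the generic
re-selection directions at a triple point** (`RebasePos.exists_goodDirs`): for a thin parallel
cell over the base `(x₁, x₂, y)` with slope `u_y ≠ 0`, non-constant width, triple point `X` and
`y`-value `Y ≠ ℓ₂(X)` there, some rational `q > 0` and `θ ∈ (0, 1)` make, for each quadrant
`(σ₀, σ₁)`, the direction `(σ₀, −σ₁ q, ν(θ))` satisfy the algebraic hypotheses of
`RebasePos.good_chamber` (finitely many exclusions). -/
theorem rebaseSimplePos_goodDirs (m : ℕ) (L : Fin m → (Fin 2 → ℚ) × ℚ) (e : Fin m → ℕ) (ℓ₂ : (Fin 2 → ℚ) × ℚ) (u v : (Fin (2 + 1) → ℚ) × ℚ) (X : Fin 2 → ℚ) (Y : ℚ) (hu : u.1 2 ≠ 0) (hpar : u.1 2 = v.1 2) (hw : (v - u).1 0 ≠ 0 ∨ (v - u).1 1 ≠ 0) (hY : Y - RebasePos.valX ℓ₂ X ≠ 0) : ∃ q : ℚ, 0 < q ∧ ∃ θ : ℚ, 0 < θ ∧ θ < 1 ∧ ∀ σ₀ σ₁ : ℚ, σ₀ * σ₀ =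 1 → σ₁ * σ₁ = 1 → RebasePos.dirQ σ₀ σ₁ q (RebasePos.nuQ u v σ₀ σ₁ q θ) (Fin.last 2) ≠ 0 ∧ RebasePos.dd u (RebasePos.dirQ σ₀ σ₁ q (RebasePos.nuQ u v σ₀ σ₁ q θ)) ≠ 0 ∧ RebasePos.dd u (RebasePos.dirQ σ₀ σ₁ q (RebasePos.nuQ u v σ₀ σ₁ q θ)) + θ * RebasePos.dd (v - u) (RebasePos.dirQ σ₀ σ₁ q (RebasePos.nuQ u v σ₀ σ₁ q θ)) = 0 ∧ (∀ j, RebasePos.jjE e j ≠ 0 → (RebasePos.jjL L ℓ₂ j).1 ≠ 0 → RebasePos.dd (RebasePos.jjL L ℓ₂ j) (RebasePos.dirQ σ₀ σ₁ q (RebasePos.nuQ u v σ₀ σ₁ q θ)) ≠ 0) ∧ (∀ j j', RebasePos.jjE e j ≠ 0 → RebasePos.jjE e j' ≠ 0 → RebasePos.dd (RebasePos.jjL L ℓ₂ j) (RebasePos.dirQ σ₀ σ₁ q (RebasePos.nuQ u v σ₀ σ₁ q θ)) ≠ 0 → RebasePos.dd (RebasePos.jjL L ℓ₂ j') (RebasePos.dirQ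 σ₀ σ₁ q (RebasePos.nuQ u v σ₀ σ₁ q θ)) ≠ 0 → RebasePos.dd (RebasePos.jjL L ℓ₂ j') (RebasePos.dirQ σ₀ σ₁ q (RebasePos.nuQ u v σ₀ σ₁ q θ)) • RebasePos.jjL L ℓ₂ j ≠ RebasePos.dd (RebasePos.jjL L ℓ₂ j) (RebasePos.dirQ σ₀ σ₁ q (RebasePos.nuQ u v σ₀ σ₁ q θ)) • RebasePos.jjL L ℓ₂ j' → ¬ (∃ i i' : Fin m, j = Fin.castSucc i ∧ j' = Fin.castSucc i' ∧ RebasePos.valX (L i) X = 0 ∧ RebasePos.valX (L i') X = 0) → RebasePos.evQ (RebasePos.resF (RebasePos.jjL L ℓ₂ j) (RebasePos.jjL L ℓ₂ j') (RebasePos.dirQ σ₀ σ₁ q (RebasePos.nuQ u v σ₀ σ₁ q θ))) ![X 0, X 1, Y] ≠ 0) ∧ (∀ j, RebasePos.jjE e j ≠ 0 → RebasePos.dd (RebasePos.jjL L ℓ₂ j) (RebasePos.dirQ σ₀ σ₁ q (RebasePos.nuQ u v σ₀ σ₁ q θ)) ≠ 0 → ¬ (∃ i : Fin m, j = Fin.castSucc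 i ∧ RebasePos.valX (L i) X = 0) → RebasePos.evQ (RebasePos.jjL L ℓ₂ j) ![X 0, X 1, Y] ≠ 0) :=
  RebasePos.exists_goodDirs L e ℓ₂ u v X Y hu hpar hw hY

end Summit.KontsevichZagierPeriods.ArrangementNormalForm.JanusBands
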